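import Summits.ValiantsHypothesis.ValiantsHypothesis.Theorems.KPlusLogSqLawValuativeDoorRankOneExpansion
import Summits.ValiantsHypothesis.ValiantsHypothesis.Theorems.KPlusLogSqLawValuativeDoorTopSets

/-!
# LINE `valuative_door` (crux `WeakLifting`, stmt-ValiantsHypothesis-19561) — ASSEMBLY of plan steps 1–7 and THE LINE'S FIRST
# `Theorems/…` TARGET `ValRankOneSharpModularDiss`, LITERALLY (val-idea-24 g3 `valuative_door-plan-rankone.md` rev 3)

HONEST FRAMING.  Helper / target file (cell `pub-symmetroid`, seat val-sym-lift-p1 g21, 2026-08-29; `--supports 19561 --as helper`).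
It assembles `…ValuativeDoorRankOneExpansion` (Cauchy–Binet expansion of the rank-one lacunary pencil, dissociated coefficients,
dominant ⇔ strict log-maximiser) and `…ValuativeDoorTopSets` (exchange direction and rank-potential injectivity for strict top-`m` sets
of `K` lines) into:
* `card_topSets_le_sharp` — the pen's SHARP count: with pairwise distinct slopes, realisable strict top-`m` sets of `K` lines are
  `≤ m · (K − m) + 1` (the rank potential is a sum of `m` distinct ranks, so it ranges over an interval of length `m (K − m)`);
* `injective_of_dissociated` — dissociation of the `m`-selection sums forces distinct slopes when `0 < m < K`;
* `domCount_rankOnePencil_le` — for a field `F` with an absolute value `v`, dissociated exponents, NONZERO scalars and `v`-unit maximal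
  minors, the number of exponents of `det (Σ_l X^{d l} • (ε l • u_l u_lᵀ))` that strictly dominate at some radius (the skeleton's raw
  `domCount` expression) is `≤ m · (K − m) + 1` (degenerate sizes `m = 0`, `K ≤ m` included);
* `valRankOneSharpModularDiss_unfolded` — the skeleton def `ValRankOneSharpModularDiss` of `Cruxes/WeakLifting/Lines/valuative_door.lean`
  (rev 2 @84c5f76c6d22) with `npEdges` / `domCount` UNFOLDED, binder for binder: arbitrary scalars (zero letters dropped by a strictly
  monotone reindexing of the nonzero ones, `m (K' − m) ≤ m (K − m)`), dissociation as injectivity of card-`m` subset sums (docked to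
  selections by `strictMono_eq_of_image_eq`), unit minors over all injective `g`; the `CharZero` / `IsNonarchimedean` binders are carried and
  unused (crit-6 VERDICT #59 (4)).  The line file obtains its def from this theorem by `exact` (checked against a verbatim copy of the defs).
This is a CALIBRATION TARGET of the line (its table's dissociated-modular rung), not a stub: nothing here closes `WeakLifting`, and nothing
bears on vW / vB / `ValRankOneLaw`, `TropicalB`, `MatrixDescartes` (18050) or VP ≠ VNP.  [elementary assembly]
-/

set_option linter.dupNamespace false
set_option autoImplicit false

namespace Summit.ValiantsHypothesis.ValiantsHypothesis.Theorems.KPlusLogSqLaw.ValDoor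

open Polynomial Finset Matrix
open scoped BigOperators Classical

variable {F : Type*} [Field F]

/-- sum of `d` over the image of a strictly monotone selection = the selection sum. [bookkeeping] -/
theorem sum_image_eq_sum_of_strictMono {m K : ℕ} (d : Fin K → ℕ) (t : Fin m → Fin K) (ht : StrictMono t) :
    ∑ l ∈ univ.image t, d l = ∑ i, d (t i) := by
  rw [Finset.sum_image]
  intro i _ j _ h
  exact ht.injective h

/-- real version. [bookkeeping] -/
theorem sum_image_eq_sum_of_strictMono_real {m K : ℕ} (g : Fin K → ℝ) (t : Fin m → Fin K) (ht : StrictMono t) :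
    ∑ l ∈ univ.image t, g l = ∑ i, g (t i) := by
  rw [Finset.sum_image]
  intro i _ j _ h
  exact ht.injective h

/-- the ordered enumeration of an `m`-set is a strictly monotone selection with that image. [bookkeeping] -/
theorem exists_strictMono_image_eq {m K : ℕ} (T : Finset (Fin K)) (hT : T.card = m) :
    ∃ t : Fin m → Fin K, StrictMono t ∧ univ.image t = T := by
  refine ⟨T.orderEmbOfFin hT, (T.orderEmbOfFin hT).strictMono, ?_⟩
  ext x
  constructor
  · intro hx
    obtain ⟨i, _, rfl⟩ := Finset.mem_image.1 hx
    exact Finset.orderEmbOfFin_mem T hT i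
  · intro hx
    have : x ∈ Set.range (T.orderEmbOfFin hT) := by rw [Finset.range_orderEmbOfFin]; exact hx
    obtain ⟨i, hi⟩ := this
    exact Finset.mem_image.2 ⟨i, Finset.mem_univ _, hi⟩

/-- **dissociation forces distinct slopes** (when `0 < m < K`): if two letters had equal exponents, exchanging them in an `m`-selection
would give two selections with the same sum. [elementary] -/
theorem injective_of_dissociated {m K : ℕ} (d : Fin K → ℕ) (hm : 0 < m) (hmK : m < K)
    (hdiss : ∀ t t' : Fin m → Fin K, StrictMono t → StrictMono t' → ∑ i, d (t i) = ∑ i, d (t' i) → t = t') :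
    Function.Injective d := by
  intro l₁ l₂ hdl
  by_contra hne
  have hK2 : m - 1 ≤ ((univ : Finset (Fin K)) \ {l₁, l₂}).card := by
    rw [Finset.card_univ_sdiff, Fintype.card_fin, Finset.card_pair hne]
    omega
  obtain ⟨S, hSsub, hScard⟩ := Finset.exists_subset_card_eq hK2
  have hl₁S : l₁ ∉ S := fun h => by
    have h' := Finset.mem_sdiff.1 (hSsub h)
    exact h'.2 (Finset.mem_insert_self _ _)
  have hl₂S : l₂ ∉ S := fun h => by
    have h' := Finset.mem_sdiff.1 (hSsub h)
    exact h'.2 (Finset.mem_insert_of_mem (Finset.mem_singleton_self _))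
  have hc₁ : (insert l₁ S).card = m := by rw [Finset.card_insert_of_notMem hl₁S, hScard]; omega
  have hc₂ : (insert l₂ S).card = m := by rw [Finset.card_insert_of_notMem hl₂S, hScard]; omega
  obtain ⟨t₁, ht₁, hi₁⟩ := exists_strictMono_image_eq _ hc₁
  obtain ⟨t₂, ht₂, hi₂⟩ := exists_strictMono_image_eq _ hc₂
  have hsum : ∑ i, d (t₁ i) = ∑ i, d (t₂ i) := by
    rw [← sum_image_eq_sum_of_strictMono d t₁ ht₁, ← sum_image_eq_sum_of_strictMono d t₂ ht₂, hi₁, hi₂,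
      Finset.sum_insert hl₁S, Finset.sum_insert hl₂S, hdl]
  have heq := hdiss t₁ t₂ ht₁ ht₂ hsum
  have hins : insert l₁ S = insert l₂ S := by rw [← hi₁, ← hi₂, heq]
  have hmem : l₁ ∈ insert l₂ S := hins ▸ Finset.mem_insert_self l₁ S
  rcases Finset.mem_insert.1 hmem with h | h
  · exact hne h
  · exact hl₁S h

/-- **ASSEMBLY — dominant exponents of a dissociated unit-minor rank-one pencil are few.**  Under dissociation of the `m`-selection
sums of `d`, nonzero scalars `ε` and `v`-unit maximal minors of `u`, the number of exponents of the rank-one lacunary determinant that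
strictly dominate at some radius is at most `m · (K − m) + 1` (so `npEdges ≤ m (K − m)`, the pen's sharp modular bound).
[elementary assembly of the two helper files] -/
theorem domCount_rankOnePencil_le (v : AbsoluteValue F ℝ) (m K : ℕ) (d : Fin K → ℕ) (ε : Fin K → F) (u : Fin K → Fin m → F)
    (hdiss : ∀ t t' : Fin m → Fin K, StrictMono t → StrictMono t' → ∑ i, d (t i) = ∑ i, d (t' i) → t = t')
    (hε : ∀ l, ε l ≠ 0)
    (hunit : ∀ t : Fin m → Fin K, StrictMono t → v (Matrix.det (Matrix.of fun i j => u (t j) i)) = 1) :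
    ((Matrix.det (∑ l, ((X : F[X]) ^ d l) • (ε l • Matrix.vecMulVec (u l) (u l)).map (C : F →+* F[X]))).support.filter
        fun E => ∃ r : ℝ, 0 < r ∧
          ∀ E' ∈ (Matrix.det (∑ l, ((X : F[X]) ^ d l) • (ε l • Matrix.vecMulVec (u l) (u l)).map (C : F →+* F[X]))).support,
            E' ≠ E →
            v ((Matrix.det (∑ l, ((X : F[X]) ^ d l) • (ε l • Matrix.vecMulVec (u l) (u l)).map (C : F →+* F[X]))).coeff E') * r ^ E'
              < v ((Matrix.det (∑ l, ((X : F[X]) ^ d l) • (ε l • Matrix.vecMulVec (u l) (u l)).map (C : F →+* F[X]))).coeff E) * r ^ E).card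
      ≤ m * (K - m) + 1 := by
  set f : F[X] := Matrix.det (∑ l, ((X : F[X]) ^ d l) • (ε l • Matrix.vecMulVec (u l) (u l)).map (C : F →+* F[X])) with hf
  set D := f.support.filter fun E => ∃ r : ℝ, 0 < r ∧ ∀ E' ∈ f.support, E' ≠ E →
      v (f.coeff E') * r ^ E' < v (f.coeff E) * r ^ E with hD
  -- the lines: intercepts `a l = log v (ε l)`, slopes `d l`
  set a : Fin K → ℝ := fun l => Real.log (v (ε l)) with ha
  -- (1) every support exponent is a selection sum
  have hsel : ∀ E ∈ f.support, ∃ t : Fin m → Fin K, StrictMono t ∧ ∑ i, d (t i) = E := by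
    intro E hE
    by_contra hno
    push Not at hno
    have h0 := coeff_det_rankOnePencil_eq_zero m K d ε u E (fun t ht heq => hno t ht heq)
    exact (Polynomial.mem_support_iff.1 hE) (by rw [hf]; exact h0)
  -- (2) coefficient valuation of a selection sum: product of letter valuations (positive), log = Σ a
  have hcoeffv : ∀ t : Fin m → Fin K, StrictMono t → v (f.coeff (∑ i, d (t i))) = ∏ i, v (ε (t i)) := by
    intro t ht
    rw [hf]
    exact absoluteValue_coeff_det_rankOnePencil_of_unit m K d ε u hdiss t ht v (hunit t ht)
  have hcoeff_ne : ∀ t : Fin m → Fin K, StrictMono t → f.coeff (∑ i, d (t i)) ≠ 0 := by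
    intro t ht hzero
    have h1 := hcoeffv t ht
    rw [hzero, map_zero] at h1
    exact (Finset.prod_pos fun i _ => v.pos (hε (t i))).ne' h1.symm
  have hlogcoeff : ∀ t : Fin m → Fin K, StrictMono t → Real.log (v (f.coeff (∑ i, d (t i)))) = ∑ i, a (t i) := by
    intro t ht
    rw [hcoeffv t ht, Real.log_prod]
    intro i _
    exact (v.pos (hε (t i))).ne'
  -- (3) choose the selection of each dominant exponent
  choose sel hsel_mono hsel_sum using hsel
  -- the top set of E (junk value `∅` off the support)
  set TS : ℕ → Finset (Fin K) := fun E => if h : E ∈ f.support then univ.image (sel E h) else ∅ with hTS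
  have hTS_of : ∀ E (h : E ∈ f.support), TS E = univ.image (sel E h) := by
    intro E h
    rw [hTS]
    simp only [dif_pos h]
  have hTS_card : ∀ E (h : E ∈ f.support), (TS E).card = m := by
    intro E hE
    rw [hTS_of E hE, Finset.card_image_of_injective _ (hsel_mono E hE).injective, Finset.card_univ, Fintype.card_fin]
  have hTS_sum : ∀ E (h : E ∈ f.support), ∑ l ∈ TS E, d l = E := by
    intro E hE
    rw [hTS_of E hE, sum_image_eq_sum_of_strictMono d (sel E hE) (hsel_mono E hE), hsel_sum E hE]
  -- (4) TS is injective on D (indeed on the support)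
  have hTS_inj : Set.InjOn TS (D : Set ℕ) := by
    intro E hE E' hE' h
    have hEs : E ∈ f.support := (Finset.mem_filter.1 (Finset.mem_coe.1 hE)).1
    have hE's : E' ∈ f.support := (Finset.mem_filter.1 (Finset.mem_coe.1 hE')).1
    rw [← hTS_sum E hEs, ← hTS_sum E' hE's, h]
  -- (5) each TS E, E ∈ D, is a strict top set of the lines at s = log r
  have hTS_top : ∀ E ∈ D, ∃ s : ℝ, ∀ l ∈ TS E, ∀ l' ∉ TS E, a l' + s * d l' < a l + s * d l := by
    intro E hED
    obtain ⟨hEs, r, hr, hdom⟩ := Finset.mem_filter.1 hED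
    refine ⟨Real.log r, fun l hl l' hl' => ?_⟩
    -- the swapped set T' = TS E - l + l'
    set T' : Finset (Fin K) := insert l' ((TS E).erase l) with hT'
    have hl'T : l' ∉ (TS E).erase l := fun h => hl' (Finset.mem_of_mem_erase h)
    have hT'card : T'.card = m := by
      rw [hT', Finset.card_insert_of_notMem hl'T, Finset.card_erase_of_mem hl, hTS_card E hEs]
      have : 0 < m := by
        rw [← hTS_card E hEs]; exact Finset.card_pos.2 ⟨l, hl⟩
      omega
    obtain ⟨t', ht'mono, ht'img⟩ := exists_strictMono_image_eq T' hT'card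
    -- its exponent E' is in the support and differs from E
    set E' : ℕ := ∑ i, d (t' i) with hE'
    have hE'supp : E' ∈ f.support := Polynomial.mem_support_iff.2 (hcoeff_ne t' ht'mono)
    have hsumT' : ∑ x ∈ T', d x = E' := by rw [← ht'img, sum_image_eq_sum_of_strictMono d t' ht'mono]
    have hne : E' ≠ E := by
      intro heq
      -- then sel E = t' by dissociation, so TS E = T', contradiction with l ∈ TS E \ T'
      have hsame : t' = sel E hEs := hdiss t' (sel E hEs) ht'mono (hsel_mono E hEs) (by rw [hsel_sum E hEs]; exact heq)
      have : TS E = T' := by rw [← ht'img, hsame, hTS_of E hEs]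
      have hlT' : l ∈ T' := this ▸ hl
      rw [hT', Finset.mem_insert] at hlT'
      rcases hlT' with h | h
      · exact hl' (h ▸ hl)
      · exact (Finset.notMem_erase l (TS E)) h
    -- dominance in log form
    have hlog := (dominant_iff_log v f hEs hr).1 hdom E' hE'supp hne
    -- rewrite both coefficient logs as sums over the top sets
    have hlogE : Real.log (v (f.coeff E)) = ∑ x ∈ TS E, a x := by
      rw [hTS_of E hEs, sum_image_eq_sum_of_strictMono_real a (sel E hEs) (hsel_mono E hEs),
        ← hlogcoeff (sel E hEs) (hsel_mono E hEs), hsel_sum E hEs]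
    have hlogE' : Real.log (v (f.coeff E')) = ∑ x ∈ T', a x := by
      rw [hE', hlogcoeff t' ht'mono, ← ht'img]
      exact (sum_image_eq_sum_of_strictMono_real a t' ht'mono).symm
    have hEsum : (E : ℝ) = ∑ x ∈ TS E, (d x : ℝ) := by exact_mod_cast (hTS_sum E hEs).symm
    have hE'sum : (E' : ℝ) = ∑ x ∈ T', (d x : ℝ) := by exact_mod_cast hsumT'.symm
    rw [hlogE, hlogE', hEsum, hE'sum, Finset.sum_mul, Finset.sum_mul, ← Finset.sum_add_distrib, ← Finset.sum_add_distrib] at hlog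
    -- compare the two sums: T' = TS E - l + l'
    have hsplitE : ∑ x ∈ TS E, (a x + (d x : ℝ) * Real.log r)
        = (a l + (d l : ℝ) * Real.log r) + ∑ x ∈ (TS E).erase l, (a x + (d x : ℝ) * Real.log r) :=
      (Finset.add_sum_erase (TS E) (fun x => a x + (d x : ℝ) * Real.log r) hl).symm
    have hsplitE' : ∑ x ∈ T', (a x + (d x : ℝ) * Real.log r)
        = (a l' + (d l' : ℝ) * Real.log r) + ∑ x ∈ (TS E).erase l, (a x + (d x : ℝ) * Real.log r) := by
      rw [hT', Finset.sum_insert hl'T]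
    rw [hsplitE, hsplitE'] at hlog
    linarith
  -- (6) count: D injects into the family of realisable strict top sets of size m
  have hcardD : D.card = (D.image TS).card := (Finset.card_image_of_injOn hTS_inj).symm
  rw [hcardD]
  have hfam_card : ∀ T ∈ D.image TS, T.card = m := by
    intro T hT
    obtain ⟨E, hED, rfl⟩ := Finset.mem_image.1 hT
    exact hTS_card E (Finset.mem_filter.1 hED).1
  have hfam_top : ∀ T ∈ D.image TS, ∃ s : ℝ, ∀ l ∈ T, ∀ l' ∉ T, a l' + s * d l' < a l + s * d l := by
    intro T hT
    obtain ⟨E, hED, rfl⟩ := Finset.mem_image.1 hT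
    exact hTS_top E hED
  -- degenerate sizes: m = 0 (only `∅`) and K ≤ m (only `univ`)
  by_cases hm0 : m = 0
  · have hsub : D.image TS ⊆ {∅} := fun T hT =>
      Finset.mem_singleton.2 (Finset.card_eq_zero.1 (by rw [hfam_card T hT, hm0]))
    calc (D.image TS).card ≤ ({∅} : Finset (Finset (Fin K))).card := Finset.card_le_card hsub
      _ = 1 := Finset.card_singleton _
      _ ≤ m * (K - m) + 1 := by omega
  by_cases hKm : K ≤ m
  · have hsub : D.image TS ⊆ {univ} := by
      intro T hT
      have h1 := hfam_card T hT
      have h2 : T.card ≤ K := by simpa only [Fintype.card_fin] using Finset.card_le_univ T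
      exact Finset.mem_singleton.2 (Finset.eq_univ_of_card T (by rw [Fintype.card_fin]; omega))
    calc (D.image TS).card ≤ ({univ} : Finset (Finset (Fin K))).card := Finset.card_le_card hsub
      _ = 1 := Finset.card_singleton _
      _ ≤ m * (K - m) + 1 := by omega
  -- main case 0 < m < K: dissociation makes the slopes distinct, and the sharp count applies
  have hd : Function.Injective d := injective_of_dissociated d (Nat.pos_of_ne_zero hm0) (by omega) hdiss
  exact card_topSets_le_sharp a d hd m (D.image TS) hfam_card hfam_top

/-- two strictly monotone selections with the same image coincide. [bookkeeping: `StrictMono.range_inj`] -/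
theorem strictMono_eq_of_image_eq {m K : ℕ} {t t' : Fin m → Fin K} (ht : StrictMono t) (ht' : StrictMono t')
    (h : univ.image t = univ.image t') : t = t' := by
  apply (StrictMono.range_inj ht ht').1
  have h' := congrArg (fun s : Finset (Fin K) => (s : Set (Fin K))) h
  simpa only [Finset.coe_image, Finset.coe_univ, Set.image_univ] using h'

/-- **THE LINE'S FIRST `Theorems/…` TARGET, LITERALLY — `ValRankOneSharpModularDiss` UNFOLDED** (skeleton
`Cruxes/WeakLifting/Lines/valuative_door.lean` rev 2 @84c5f76c6d22; the line file obtains its def from this theorem by `exact`).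
For every field `F` of characteristic zero with an absolute value `v` (the non-archimedean hypothesis is carried but NOT used — crit-6
VERDICT #59 (4)), all `m K`, exponents `d` with injective `m`-subset sums, ARBITRARY scalars `ε` (zero letters are dropped by reindexing the
nonzero ones, bridge (b)) and vectors `u` with `v`-unit maximal minors: `npEdges = domCount − 1 ≤ m · (K − m)` for the rank-one lacunary
determinant.  Bridges (a) StrictMono selections ↔ card-`m` subsets (`strictMono_eq_of_image_eq`) and (c) dominant ⇔ unique strict
maximiser are inside `domCount_rankOnePencil_le`. [assembly; def-free restatement of the skeleton target] -/
theorem valRankOneSharpModularDiss_unfolded :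
    ∀ (F : Type) [Field F] [CharZero F] (v : AbsoluteValue F ℝ), IsNonarchimedean v →
      ∀ (m K : ℕ) (d : Fin K → ℕ) (ε : Fin K → F) (u : Fin K → Fin m → F),
        Function.Injective (fun I : {s : Finset (Fin K) // s.card = m} => ∑ l ∈ I.1, d l) →
        (∀ g : Fin m → Fin K, Function.Injective g → v (Matrix.det (Matrix.of fun i j => u (g j) i)) = 1) →
        ((Matrix.det (∑ l, ((Polynomial.X : Polynomial F) ^ d l) •
            (ε l • Matrix.vecMulVec (u l) (u l)).map Polynomial.C)).support.filter fun E => ∃ r : ℝ, 0 < r ∧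
            ∀ E' ∈ (Matrix.det (∑ l, ((Polynomial.X : Polynomial F) ^ d l) •
              (ε l • Matrix.vecMulVec (u l) (u l)).map Polynomial.C)).support, E' ≠ E →
              v ((Matrix.det (∑ l, ((Polynomial.X : Polynomial F) ^ d l) •
                (ε l • Matrix.vecMulVec (u l) (u l)).map Polynomial.C)).coeff E') * r ^ E'
              < v ((Matrix.det (∑ l, ((Polynomial.X : Polynomial F) ^ d l) •
                (ε l • Matrix.vecMulVec (u l) (u l)).map Polynomial.C)).coeff E) * r ^ E).card - 1
          ≤ m * (K - m) := by
  intro F _ _ v _ m K d ε u hinj hunit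
  refine Nat.sub_le_iff_le_add.2 ?_
  -- (b) drop the zero letters: reindex the nonzero ones by a strictly monotone `t₀ : Fin K' → Fin K`
  obtain ⟨K', hK'eq⟩ : ∃ K' : ℕ, ((univ : Finset (Fin K)).filter fun l => ε l ≠ 0).card = K' := ⟨_, rfl⟩
  obtain ⟨t₀, ht₀, himg⟩ := exists_strictMono_image_eq ((univ : Finset (Fin K)).filter fun l => ε l ≠ 0) hK'eq
  have hp : ∀ l ∈ (univ : Finset (Fin K)),
      ((X : F[X]) ^ d l) • (ε l • Matrix.vecMulVec (u l) (u l)).map (C : F →+* F[X]) ≠ 0 → ε l ≠ 0 := by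
    intro l _ hne hεl
    exact hne (by rw [hεl, zero_smul, Matrix.map_zero _ (map_zero C), smul_zero])
  have hpencil : (∑ l, ((X : F[X]) ^ d l) • (ε l • Matrix.vecMulVec (u l) (u l)).map (C : F →+* F[X]))
      = ∑ j, ((X : F[X]) ^ d (t₀ j)) • (ε (t₀ j) • Matrix.vecMulVec (u (t₀ j)) (u (t₀ j))).map (C : F →+* F[X]) := by
    rw [← Finset.sum_filter_of_ne hp, ← himg, Finset.sum_image fun x _ y _ h => ht₀.injective h]
  rw [hpencil]
  have hK' : K' ≤ K := by
    rw [← hK'eq]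
    simpa only [Fintype.card_fin] using Finset.card_le_univ ((univ : Finset (Fin K)).filter fun l => ε l ≠ 0)
  -- hypotheses of the assembly bound in the reindexed format
  have hdiss' : ∀ t t' : Fin m → Fin K', StrictMono t → StrictMono t' →
      ∑ i, d (t₀ (t i)) = ∑ i, d (t₀ (t' i)) → t = t' := by
    intro t t' ht ht' hsum
    have hI : (univ.image (t₀ ∘ t)).card = m := by
      rw [Finset.card_image_of_injective _ (ht₀.comp ht).injective, Finset.card_univ, Fintype.card_fin]
    have hI' : (univ.image (t₀ ∘ t')).card = m := by
      rw [Finset.card_image_of_injective _ (ht₀.comp ht').injective, Finset.card_univ, Fintype.card_fin]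
    have hsums : ∑ l ∈ univ.image (t₀ ∘ t), d l = ∑ l ∈ univ.image (t₀ ∘ t'), d l := by
      rw [sum_image_eq_sum_of_strictMono d (t₀ ∘ t) (ht₀.comp ht), sum_image_eq_sum_of_strictMono d (t₀ ∘ t') (ht₀.comp ht')]
      simpa only [Function.comp_apply] using hsum
    have hsub : (⟨univ.image (t₀ ∘ t), hI⟩ : {s : Finset (Fin K) // s.card = m}) = ⟨univ.image (t₀ ∘ t'), hI'⟩ := hinj hsums
    have hcomp : t₀ ∘ t = t₀ ∘ t' :=
      strictMono_eq_of_image_eq (ht₀.comp ht) (ht₀.comp ht') (congrArg Subtype.val hsub)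
    funext i
    exact ht₀.injective (congrFun hcomp i)
  have hε' : ∀ j : Fin K', ε (t₀ j) ≠ 0 := by
    intro j
    have hj : t₀ j ∈ (univ : Finset (Fin K)).filter fun l => ε l ≠ 0 :=
      himg ▸ Finset.mem_image_of_mem t₀ (Finset.mem_univ j)
    exact (Finset.mem_filter.1 hj).2
  have hunit' : ∀ t : Fin m → Fin K', StrictMono t →
      v (Matrix.det (Matrix.of fun i j => u (t₀ (t j)) i)) = 1 :=
    fun t ht => hunit (t₀ ∘ t) (ht₀.comp ht).injective
  have hmain := domCount_rankOnePencil_le v m _ (fun j => d (t₀ j)) (fun j => ε (t₀ j)) (fun j => u (t₀ j)) hdiss' hε' hunit'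
  have hmono : m * (K' - m) + 1 ≤ m * (K - m) + 1 :=
    Nat.add_le_add_right (Nat.mul_le_mul_left m (Nat.sub_le_sub_right hK' m)) 1
  exact hmain.trans hmono

end Summit.ValiantsHypothesis.ValiantsHypothesis.Theorems.KPlusLogSqLaw.ValDoor
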